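import Mathlib
import HarnessLib
import Summits.Ventures.LatticeQCDFlow.Exactness.WilsonUniformJitterHMC
import Summits.Ventures.LatticeQCDFlow.Exactness.NCMCGeneralSpaceTauIntWindowConsistency
import Summits.Ventures.LatticeQCDFlow.Exactness.NCMCGeneralSpaceDoeblinPowerEveryStart
import Summits.Ventures.LatticeQCDFlow.Scoring.DoeblinPowerBatchMeansTauInt
import Summits.Ventures.LatticeQCDFlow.Scoring.ChainGlivenkoCantelli
import Summits.Ventures.LatticeQCDFlow.Exactness.NCMCGeneralSpaceGammaMethodWindow

/-!
# Statistics of a run of the engine's jittered `SU(N)` HMC AS RUN (uniform `tau_jitter` law): the printed Γ-method `τ̂_int,W` is consistent, strong laws from every start, exponential decorrelation — whenever `τ(1 − j) < τ₀`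

HONEST FRAMING: exact (Metropolis-corrected) sampling algorithms for lattice gauge theory;
figures of merit are autocorrelation/cost numbers at stated couplings and volumes; no
continuum-physics claim.

Venture `LatticeQCDFlow` (cell pub-lqcd), topic `Exactness`, FANOUT row 9 (eng-latcore, GEN-24; the engine
`latflow.core.hmc.HMC(f, β, 'leapfrog').trajectory(τ, nstep, tau_jitter = j)` — trajectory length `τ(1 + j(2u − 1))`,
`u ∼ U(0,1)`, `nstep` fixed — alone and inside `updates.composite_sweep(f, β, 'hmc', n_or)`).  NEW WORK of the cell over
GEN-24's `WilsonUniformJitterHMC.lean` (`uniformJitterLaw`, `wilson_uniformJitterHMC_invariant`,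
`wilson_uniformJitterHMC_certificate`, `wilson_uniformJitterHMC_exactStep_certificate`) and the generic theorems of row 13/31 (`NCMCGeneralSpaceTauIntWindowConsistency`: `GeneralNCMC.chain_tauIntWindow_tendstoInMeasure_of_nHit`; `NCMCGeneralSpaceDoeblinPowerEveryStart`: `GeneralNCMC.tendsto_sum_div_anyLaw_of_nHit_minorised`; `NCMCGeneralSpaceGammaMethodWindow`: `GeneralNCMC.abs_autocov_centred_le_of_nHit`, `decay_of_nHit`) and row 8 (`Scoring.chain_sampleVariance_ae_tendsto_of_nHit`); the atom versions are GEN-23's `EngineGammaMethodTauInt.lean`, `EngineStrongLaws.lean`, `EngineExponentialDecorrelation.lean`.  Nothing is cited as a fact;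
no number is claimed.

THE DIFFERENCE FROM GEN-23 (whose statements these repeat word for word for the jittered chain): the hypothesis is no
longer an ATOM `l₀` of the jitter law with a short trajectory (constant carrying `η{l₀}` — `2⁻⁵³` for the code's
uniform; none at all for the idealised law) but the engine's parameters as run: `nstep ≥ 1`, production length `τ > 0`,
jitter `0 < j ≤ 1` with `τ(1 − j) < τ₀`; `j = 1` qualifies at EVERY `τ`.

## Content (`K = wilsonJitterHMCL N d L β nstep (uniformJitterLaw τ j)`, `π = wilsonMeasure (β/N)`; every theorem:
## `∃ τ₀ > 0` on `N, d, L, β` only, then for EVERY `nstep ≥ 1`, `τ > 0`, `0 < j ≤ 1` with `τ(1 − j) < τ₀`)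

* Γ-METHOD: **`wilson_uniformJitterHMC_gammaHat_tendstoInMeasure`** (every lag `Γ̂_N(t) → C_f̄(t)` in probability),
  **`wilson_uniformJitterHMC_tauIntWindow_tendstoInMeasure`** (scorer A's `τ̂_int,W → τ_f` when `Var_π f > 0`, `W_N → ∞`,
  `W_N³/N → 0`), **`wilson_uniformJitterHMC_tauIntWindow_indicator_tendstoInMeasure`** (event: `→` FITNESS
  `tauInt (setACF K π A)`); **`wilson_uniformJitterHMC_exactStep_tauIntWindow_{,indicator_}tendstoInMeasure`** (+ ANY exact step).
* STRONG LAWS FROM EVERY START: **`wilson_uniformJitterHMC_timeAverage_ae_tendsto`** (ergodic theorem for EVERY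
  `π`-integrable `φ`, every initial law), **`wilson_uniformJitterHMC_sampleVariance_ae_tendsto`**,
  **`wilson_uniformJitterHMC_exactStep_timeAverage_ae_tendsto`**.
* EXPONENTIAL DECORRELATION: **`wilson_uniformJitterHMC_abs_autocov_le`** (`|C_f̄(t)| ≤ 2(2C)²(1−ε′)^{⌊t/m⌋}` for EVERY
  bounded observable), **`wilson_uniformJitterHMC_relaxation_le`** (thermalisation from ANY start),
  **`wilson_uniformJitterHMC_exactStep_abs_autocov_le`**, **`wilson_uniformJitterHMC_exactStep_relaxation_le`**.

NOT CLAIMED: any value of `τ₀` or of the constants; anything when `τ(1 − j) ≥ τ₀`; rates beyond those stated;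
unbounded observables; OMF words; floating point.
-/

noncomputable section

namespace Summit.Ventures.LatticeQCDFlow.Exactness

open MeasureTheory ProbabilityTheory ProbabilityTheory.Kernel Set Function Filter Topology
open Literature.MathematicalPhysics.QuantumFieldTheory
open Literature.MathematicalPhysics.QuantumLattice (fundamentalRep continuous_fundamentalRep connectedSpace_specialUnitaryGroup)
open Summit.Ventures.LatticeQCDFlow.Scoring (tauInt autocov rhoHat gammaHat tauIntWindow kop)
open scoped ENNReal Matrix Matrix.Norms.Operator NNReal

set_option backward.isDefEq.respectTransparency false

/-! ## From `EngineGammaMethodTauInt.lean` (GEN-23, atom version) — the uniform-law twin -/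

section UniformJitter

variable {N d L : ℕ} [NeZero N] [NeZero L] (β : ℝ)

/-- **EVERY LAG ESTIMATE OF THE JITTERED ENGINE HMC IS CONSISTENT, FROM EVERY START**: there is `τ₀ > 0` (depending
on `N, d, L, β` only) such that whenever `nstep ≥ 1`, `τ > 0`, `0 < j ≤ 1` and `τ(1 − j) < τ₀`, for every bounded measurable `f`, every lag `t` and every initial law `μ₀`,
`Γ̂_N(t) → C_f̄(t)` in `P_{μ₀}`-probability. -/
theorem wilson_uniformJitterHMC_gammaHat_tendstoInMeasure :
    ∃ τ₀ : ℝ, 0 < τ₀ ∧ ∀ (nstep : ℕ) (τ j : ℝ), 1 ≤ nstep → 0 < τ → 0 < j → j ≤ 1 → τ * (1 - j) < τ₀ →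
      ∀ (f : GaugeConfig d L (Matrix.specialUnitaryGroup (Fin N) ℂ) → ℝ), Measurable f → ∀ C : ℝ, (∀ U, |f U| ≤ C) →
      ∀ (t : ℕ) (μ₀ : Measure (GaugeConfig d L (Matrix.specialUnitaryGroup (Fin N) ℂ))) [IsProbabilityMeasure μ₀],
        TendstoInMeasure (Kernel.trajMeasure (X := fun _ : ℕ => GaugeConfig d L (Matrix.specialUnitaryGroup (Fin N) ℂ)) μ₀
              (fun n : ℕ => (wilsonJitterHMCL N d L β nstep (uniformJitterLaw τ j)).comap
                (fun h : (i : ↥(Finset.Iic n)) → GaugeConfig d L (Matrix.specialUnitaryGroup (Fin N) ℂ) =>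
                  h ⟨n, Finset.mem_Iic.2 le_rfl⟩) (measurable_pi_apply _)))
          (fun (n : ℕ) (x : ℕ → GaugeConfig d L (Matrix.specialUnitaryGroup (Fin N) ℂ)) => gammaHat (fun i => f (x i)) n t)
          atTop (fun _ => autocov (wilsonJitterHMCL N d L β nstep (uniformJitterLaw τ j))
            (wilsonMeasure (d := d) (L := L) (fundamentalRep (Fin N)) (β / N))
            (fun y => f y - ∫ z, f z ∂(wilsonMeasure (d := d) (L := L) (fundamentalRep (Fin N)) (β / N))) t) := by
  obtain ⟨τ₀, hτ₀, h⟩ := wilson_uniformJitterHMC_certificate (N := N) (d := d) (L := L) β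
  refine ⟨τ₀, hτ₀, fun nstep τ j hn hτ hj hj1 hshort f hf C hC t μ₀ _ => ?_⟩
  obtain ⟨m, ε', hm, hε0, hε1, hmin⟩ := h nstep τ j hn hτ hj hj1 hshort
  exact GeneralNCMC.chain_gammaHat_tendstoInMeasure_of_nHit μ₀
    (wilson_uniformJitterHMC_invariant (N := N) (d := d) (L := L) β nstep τ j) hε0.ne' hmin hm hf hC t

/-- **THE PRINTED `τ̂_int,W` OF THE JITTERED ENGINE HMC IS CONSISTENT, FROM EVERY START**: same `τ₀`; for every
bounded measurable `f` with `Var_π f > 0`, every initial law `μ₀` and every window sequence `W_N → ∞` with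
`W_N³/N → 0`, `tauIntWindow (rhoHat (f ∘ U) N) (W N) → τ_f = σ²_f/(2 C_f̄(0))` in `P_{μ₀}`-probability. -/
theorem wilson_uniformJitterHMC_tauIntWindow_tendstoInMeasure :
    ∃ τ₀ : ℝ, 0 < τ₀ ∧ ∀ (nstep : ℕ) (τ j : ℝ), 1 ≤ nstep → 0 < τ → 0 < j → j ≤ 1 → τ * (1 - j) < τ₀ →
      ∀ (f : GaugeConfig d L (Matrix.specialUnitaryGroup (Fin N) ℂ) → ℝ), Measurable f → ∀ C : ℝ, (∀ U, |f U| ≤ C) →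
        0 < autocov (wilsonJitterHMCL N d L β nstep (uniformJitterLaw τ j)) (wilsonMeasure (d := d) (L := L) (fundamentalRep (Fin N)) (β / N))
          (fun y => f y - ∫ z, f z ∂(wilsonMeasure (d := d) (L := L) (fundamentalRep (Fin N)) (β / N))) 0 →
      ∀ (μ₀ : Measure (GaugeConfig d L (Matrix.specialUnitaryGroup (Fin N) ℂ))) [IsProbabilityMeasure μ₀] (W : ℕ → ℕ),
        Tendsto W atTop atTop → Tendsto (fun n => (W n : ℝ) ^ 3 / n) atTop (nhds 0) →
        TendstoInMeasure (Kernel.trajMeasure (X := fun _ : ℕ => GaugeConfig d L (Matrix.specialUnitaryGroup (Fin N) ℂ)) μ₀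
              (fun n : ℕ => (wilsonJitterHMCL N d L β nstep (uniformJitterLaw τ j)).comap
                (fun h : (i : ↥(Finset.Iic n)) → GaugeConfig d L (Matrix.specialUnitaryGroup (Fin N) ℂ) =>
                  h ⟨n, Finset.mem_Iic.2 le_rfl⟩) (measurable_pi_apply _)))
          (fun (n : ℕ) (x : ℕ → GaugeConfig d L (Matrix.specialUnitaryGroup (Fin N) ℂ)) =>
            tauIntWindow (rhoHat (fun i => f (x i)) n) (W n))
          atTop (fun _ =>
            (autocov (wilsonJitterHMCL N d L β nstep (uniformJitterLaw τ j)) (wilsonMeasure (d := d) (L := L) (fundamentalRep (Fin N)) (β / N))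
                (fun y => f y - ∫ z, f z ∂(wilsonMeasure (d := d) (L := L) (fundamentalRep (Fin N)) (β / N))) 0
              + 2 * ∑' t, autocov (wilsonJitterHMCL N d L β nstep (uniformJitterLaw τ j))
                (wilsonMeasure (d := d) (L := L) (fundamentalRep (Fin N)) (β / N))
                (fun y => f y - ∫ z, f z ∂(wilsonMeasure (d := d) (L := L) (fundamentalRep (Fin N)) (β / N))) (t + 1))
            / (2 * autocov (wilsonJitterHMCL N d L β nstep (uniformJitterLaw τ j)) (wilsonMeasure (d := d) (L := L) (fundamentalRep (Fin N)) (β / N))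
                (fun y => f y - ∫ z, f z ∂(wilsonMeasure (d := d) (L := L) (fundamentalRep (Fin N)) (β / N))) 0)) := by
  obtain ⟨τ₀, hτ₀, h⟩ := wilson_uniformJitterHMC_certificate (N := N) (d := d) (L := L) β
  refine ⟨τ₀, hτ₀, fun nstep τ j hn hτ hj hj1 hshort f hf C hC hvar μ₀ _ W hW hW3 => ?_⟩
  obtain ⟨m, ε', hm, hε0, hε1, hmin⟩ := h nstep τ j hn hτ hj hj1 hshort
  exact GeneralNCMC.chain_tauIntWindow_tendstoInMeasure_of_nHit μ₀
    (wilson_uniformJitterHMC_invariant (N := N) (d := d) (L := L) β nstep τ j) hε0.ne' hmin hm hf hC hvar hW hW3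

/-- **FOR AN EVENT, THE PRINTED `τ̂_int,W` CONVERGES TO THE FITNESS `τ_int`**: same `τ₀`; for every measurable event
`A` with `0 < π(A) < 1` (a topological sector, a level set of the plaquette, …), every initial law and every window
sequence `W_N → ∞`, `W_N³/N → 0`, the printed `τ̂` of the indicator series converges in probability to
`Scoring.tauInt (setACF K π A)` — the quantity bounded by ONE constant in `SUNJitteredHMCFiguresOfMerit`. -/
theorem wilson_uniformJitterHMC_tauIntWindow_indicator_tendstoInMeasure :
    ∃ τ₀ : ℝ, 0 < τ₀ ∧ ∀ (nstep : ℕ) (τ j : ℝ), 1 ≤ nstep → 0 < τ → 0 < j → j ≤ 1 → τ * (1 - j) < τ₀ →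
      ∀ (A : Set (GaugeConfig d L (Matrix.specialUnitaryGroup (Fin N) ℂ))), MeasurableSet A →
        0 < (wilsonMeasure (d := d) (L := L) (fundamentalRep (Fin N)) (β / N)).real A →
        (wilsonMeasure (d := d) (L := L) (fundamentalRep (Fin N)) (β / N)).real A < 1 →
      ∀ (μ₀ : Measure (GaugeConfig d L (Matrix.specialUnitaryGroup (Fin N) ℂ))) [IsProbabilityMeasure μ₀] (W : ℕ → ℕ),
        Tendsto W atTop atTop → Tendsto (fun n => (W n : ℝ) ^ 3 / n) atTop (nhds 0) →
        TendstoInMeasure (Kernel.trajMeasure (X := fun _ : ℕ => GaugeConfig d L (Matrix.specialUnitaryGroup (Fin N) ℂ)) μ₀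
              (fun n : ℕ => (wilsonJitterHMCL N d L β nstep (uniformJitterLaw τ j)).comap
                (fun h : (i : ↥(Finset.Iic n)) → GaugeConfig d L (Matrix.specialUnitaryGroup (Fin N) ℂ) =>
                  h ⟨n, Finset.mem_Iic.2 le_rfl⟩) (measurable_pi_apply _)))
          (fun (n : ℕ) (x : ℕ → GaugeConfig d L (Matrix.specialUnitaryGroup (Fin N) ℂ)) =>
            tauIntWindow (rhoHat (fun i => A.indicator (1 : GaugeConfig d L (Matrix.specialUnitaryGroup (Fin N) ℂ) → ℝ) (x i)) n) (W n))
          atTop (fun _ => tauInt (setACF (wilsonJitterHMCL N d L β nstep (uniformJitterLaw τ j))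
            (wilsonMeasure (d := d) (L := L) (fundamentalRep (Fin N)) (β / N)) A)) := by
  obtain ⟨τ₀, hτ₀, h⟩ := wilson_uniformJitterHMC_certificate (N := N) (d := d) (L := L) β
  refine ⟨τ₀, hτ₀, fun nstep τ j hn hτ hj hj1 hshort A hA h0 h1 μ₀ _ W hW hW3 => ?_⟩
  obtain ⟨m, ε', hm, hε0, hε1, hmin⟩ := h nstep τ j hn hτ hj hj1 hshort
  exact GeneralNCMC.chain_tauIntWindow_indicator_tendstoInMeasure_of_nHit μ₀
    (wilson_uniformJitterHMC_invariant (N := N) (d := d) (L := L) β nstep τ j) hε0.ne' hmin hm hA h0 h1 hW hW3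

/-! ## §2 The jittered `'hmc'` path followed by ANY exact step -/

/-- **THE PRINTED `τ̂_int,W` OF THE COMPOSITE `P ∘ K_jit` IS CONSISTENT, FROM EVERY START** — `P` ANY Markov kernel
leaving `wilsonMeasure (β/N)` invariant (any schedule of Cabibbo–Marinari over-relaxation hits, heat-bath sweeps, …);
`Var_π f > 0`, `W_N → ∞`, `W_N³/N → 0`. -/
theorem wilson_uniformJitterHMC_exactStep_tauIntWindow_tendstoInMeasure :
    ∃ τ₀ : ℝ, 0 < τ₀ ∧ ∀ (nstep : ℕ) (τ j : ℝ), 1 ≤ nstep → 0 < τ → 0 < j → j ≤ 1 → τ * (1 - j) < τ₀ →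
      ∀ (P : Kernel (GaugeConfig d L (Matrix.specialUnitaryGroup (Fin N) ℂ)) (GaugeConfig d L (Matrix.specialUnitaryGroup (Fin N) ℂ)))
        [IsMarkovKernel P], Invariant P (wilsonMeasure (d := d) (L := L) (fundamentalRep (Fin N)) (β / N)) →
      ∀ (f : GaugeConfig d L (Matrix.specialUnitaryGroup (Fin N) ℂ) → ℝ), Measurable f → ∀ C : ℝ, (∀ U, |f U| ≤ C) →
        0 < autocov (P ∘ₖ wilsonJitterHMCL N d L β nstep (uniformJitterLaw τ j)) (wilsonMeasure (d := d) (L := L) (fundamentalRep (Fin N)) (β / N))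
          (fun y => f y - ∫ z, f z ∂(wilsonMeasure (d := d) (L := L) (fundamentalRep (Fin N)) (β / N))) 0 →
      ∀ (μ₀ : Measure (GaugeConfig d L (Matrix.specialUnitaryGroup (Fin N) ℂ))) [IsProbabilityMeasure μ₀] (W : ℕ → ℕ),
        Tendsto W atTop atTop → Tendsto (fun n => (W n : ℝ) ^ 3 / n) atTop (nhds 0) →
        TendstoInMeasure (Kernel.trajMeasure (X := fun _ : ℕ => GaugeConfig d L (Matrix.specialUnitaryGroup (Fin N) ℂ)) μ₀
              (fun n : ℕ => (P ∘ₖ wilsonJitterHMCL N d L β nstep (uniformJitterLaw τ j)).comap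
                (fun h : (i : ↥(Finset.Iic n)) → GaugeConfig d L (Matrix.specialUnitaryGroup (Fin N) ℂ) =>
                  h ⟨n, Finset.mem_Iic.2 le_rfl⟩) (measurable_pi_apply _)))
          (fun (n : ℕ) (x : ℕ → GaugeConfig d L (Matrix.specialUnitaryGroup (Fin N) ℂ)) =>
            tauIntWindow (rhoHat (fun i => f (x i)) n) (W n))
          atTop (fun _ =>
            (autocov (P ∘ₖ wilsonJitterHMCL N d L β nstep (uniformJitterLaw τ j)) (wilsonMeasure (d := d) (L := L) (fundamentalRep (Fin N)) (β / N))
                (fun y => f y - ∫ z, f z ∂(wilsonMeasure (d := d) (L := L) (fundamentalRep (Fin N)) (β / N))) 0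
              + 2 * ∑' t, autocov (P ∘ₖ wilsonJitterHMCL N d L β nstep (uniformJitterLaw τ j))
                (wilsonMeasure (d := d) (L := L) (fundamentalRep (Fin N)) (β / N))
                (fun y => f y - ∫ z, f z ∂(wilsonMeasure (d := d) (L := L) (fundamentalRep (Fin N)) (β / N))) (t + 1))
            / (2 * autocov (P ∘ₖ wilsonJitterHMCL N d L β nstep (uniformJitterLaw τ j)) (wilsonMeasure (d := d) (L := L) (fundamentalRep (Fin N)) (β / N))
                (fun y => f y - ∫ z, f z ∂(wilsonMeasure (d := d) (L := L) (fundamentalRep (Fin N)) (β / N))) 0)) := by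
  obtain ⟨τ₀, hτ₀, h⟩ := wilson_uniformJitterHMC_exactStep_certificate (N := N) (d := d) (L := L) β
  refine ⟨τ₀, hτ₀, fun nstep τ j hn hτ hj hj1 hshort P _ hP f hf C hC hvar μ₀ _ W hW hW3 => ?_⟩
  obtain ⟨hinv, m, ε', hm, hε0, hε1, hmin⟩ := h nstep τ j hn hτ hj hj1 hshort P hP
  haveI := isMarkovKernel_wilsonJitterHMCL (N := N) (d := d) (L := L) β nstep (uniformJitterLaw τ j)
  exact GeneralNCMC.chain_tauIntWindow_tendstoInMeasure_of_nHit μ₀ hinv hε0.ne' hmin hm hf hC hvar hW hW3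

/-- **FOR AN EVENT OF THE COMPOSITE `P ∘ K_jit`, THE PRINTED `τ̂` CONVERGES TO THE FITNESS `τ_int`** (`0 < π(A) < 1`,
every start, `W_N → ∞`, `W_N³/N → 0`). -/
theorem wilson_uniformJitterHMC_exactStep_tauIntWindow_indicator_tendstoInMeasure :
    ∃ τ₀ : ℝ, 0 < τ₀ ∧ ∀ (nstep : ℕ) (τ j : ℝ), 1 ≤ nstep → 0 < τ → 0 < j → j ≤ 1 → τ * (1 - j) < τ₀ →
      ∀ (P : Kernel (GaugeConfig d L (Matrix.specialUnitaryGroup (Fin N) ℂ)) (GaugeConfig d L (Matrix.specialUnitaryGroup (Fin N) ℂ)))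
        [IsMarkovKernel P], Invariant P (wilsonMeasure (d := d) (L := L) (fundamentalRep (Fin N)) (β / N)) →
      ∀ (A : Set (GaugeConfig d L (Matrix.specialUnitaryGroup (Fin N) ℂ))), MeasurableSet A →
        0 < (wilsonMeasure (d := d) (L := L) (fundamentalRep (Fin N)) (β / N)).real A →
        (wilsonMeasure (d := d) (L := L) (fundamentalRep (Fin N)) (β / N)).real A < 1 →
      ∀ (μ₀ : Measure (GaugeConfig d L (Matrix.specialUnitaryGroup (Fin N) ℂ))) [IsProbabilityMeasure μ₀] (W : ℕ → ℕ),
        Tendsto W atTop atTop → Tendsto (fun n => (W n : ℝ) ^ 3 / n) atTop (nhds 0) →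
        TendstoInMeasure (Kernel.trajMeasure (X := fun _ : ℕ => GaugeConfig d L (Matrix.specialUnitaryGroup (Fin N) ℂ)) μ₀
              (fun n : ℕ => (P ∘ₖ wilsonJitterHMCL N d L β nstep (uniformJitterLaw τ j)).comap
                (fun h : (i : ↥(Finset.Iic n)) → GaugeConfig d L (Matrix.specialUnitaryGroup (Fin N) ℂ) =>
                  h ⟨n, Finset.mem_Iic.2 le_rfl⟩) (measurable_pi_apply _)))
          (fun (n : ℕ) (x : ℕ → GaugeConfig d L (Matrix.specialUnitaryGroup (Fin N) ℂ)) =>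
            tauIntWindow (rhoHat (fun i => A.indicator (1 : GaugeConfig d L (Matrix.specialUnitaryGroup (Fin N) ℂ) → ℝ) (x i)) n) (W n))
          atTop (fun _ => tauInt (setACF (P ∘ₖ wilsonJitterHMCL N d L β nstep (uniformJitterLaw τ j))
            (wilsonMeasure (d := d) (L := L) (fundamentalRep (Fin N)) (β / N)) A)) := by
  obtain ⟨τ₀, hτ₀, h⟩ := wilson_uniformJitterHMC_exactStep_certificate (N := N) (d := d) (L := L) β
  refine ⟨τ₀, hτ₀, fun nstep τ j hn hτ hj hj1 hshort P _ hP A hA h0 h1 μ₀ _ W hW hW3 => ?_⟩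
  obtain ⟨hinv, m, ε', hm, hε0, hε1, hmin⟩ := h nstep τ j hn hτ hj hj1 hshort P hP
  haveI := isMarkovKernel_wilsonJitterHMCL (N := N) (d := d) (L := L) β nstep (uniformJitterLaw τ j)
  exact GeneralNCMC.chain_tauIntWindow_indicator_tendstoInMeasure_of_nHit μ₀ hinv hε0.ne' hmin hm hA h0 h1 hW hW3

end UniformJitter

/-! ## From `EngineStrongLaws.lean` (GEN-23, atom version) — the uniform-law twin -/

section UniformJitter

variable {N d L : ℕ} [NeZero N] [NeZero L] (β : ℝ)

/-- **(L) THE ERGODIC THEOREM FROM EVERY START FOR THE JITTERED ENGINE HMC**: there is `τ₀ > 0` (depending on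
`N, d, L, β` only) such that whenever `nstep ≥ 1`, `τ > 0`, `0 < j ≤ 1` and `τ(1 − j) < τ₀`: for EVERY `π`-integrable measurable `φ` and EVERY initial law `μ₀`,
`(1/n) Σ_{i<n} φ(U_i) → ∫ φ dπ` `P_{μ₀}`-almost surely (`π = wilsonMeasure (β/N)`). -/
theorem wilson_uniformJitterHMC_timeAverage_ae_tendsto :
    ∃ τ₀ : ℝ, 0 < τ₀ ∧ ∀ (nstep : ℕ) (τ j : ℝ), 1 ≤ nstep → 0 < τ → 0 < j → j ≤ 1 → τ * (1 - j) < τ₀ →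
      ∀ (φ : GaugeConfig d L (Matrix.specialUnitaryGroup (Fin N) ℂ) → ℝ), Measurable φ →
          Integrable φ (wilsonMeasure (d := d) (L := L) (fundamentalRep (Fin N)) (β / N)) →
      ∀ (μ₀ : Measure (GaugeConfig d L (Matrix.specialUnitaryGroup (Fin N) ℂ))) [IsProbabilityMeasure μ₀],
        ∀ᵐ x ∂(Kernel.trajMeasure (X := fun _ : ℕ => GaugeConfig d L (Matrix.specialUnitaryGroup (Fin N) ℂ)) μ₀
              (fun n : ℕ => (wilsonJitterHMCL N d L β nstep (uniformJitterLaw τ j)).comap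
                (fun h : (i : ↥(Finset.Iic n)) → GaugeConfig d L (Matrix.specialUnitaryGroup (Fin N) ℂ) => h ⟨n, Finset.mem_Iic.2 le_rfl⟩)
                (measurable_pi_apply _))),
          Tendsto (fun n : ℕ => (∑ i ∈ Finset.range n, φ (x i)) / n) atTop
            (𝓝 (∫ a, φ a ∂(wilsonMeasure (d := d) (L := L) (fundamentalRep (Fin N)) (β / N)))) := by
  obtain ⟨τ₀, hτ₀, h⟩ := wilson_uniformJitterHMC_certificate (N := N) (d := d) (L := L) β
  refine ⟨τ₀, hτ₀, fun nstep τ j hn hτ hj hj1 hshort φ hφm hφ μ₀ _ => ?_⟩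
  obtain ⟨m, ε', hm, hε0, hε1, hmin⟩ := h nstep τ j hn hτ hj hj1 hshort
  exact GeneralNCMC.tendsto_sum_div_anyLaw_of_nHit_minorised
    (wilson_uniformJitterHMC_invariant (N := N) (d := d) (L := L) β nstep τ j) hε0.ne' hmin hφm hφ μ₀

/-- **(V) THE SAMPLE VARIANCE OF THE JITTERED ENGINE HMC IS STRONGLY CONSISTENT, EVERY START**: same `τ₀`; for
`|f| ≤ C` measurable and every `μ₀`, `(1/n) Σ f(U_t)² − ((1/n) Σ f(U_t))² → Var_π f` almost surely. -/
theorem wilson_uniformJitterHMC_sampleVariance_ae_tendsto :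
    ∃ τ₀ : ℝ, 0 < τ₀ ∧ ∀ (nstep : ℕ) (τ j : ℝ), 1 ≤ nstep → 0 < τ → 0 < j → j ≤ 1 → τ * (1 - j) < τ₀ →
      ∀ (f : GaugeConfig d L (Matrix.specialUnitaryGroup (Fin N) ℂ) → ℝ), Measurable f → ∀ C : ℝ, (∀ U, |f U| ≤ C) →
      ∀ (μ₀ : Measure (GaugeConfig d L (Matrix.specialUnitaryGroup (Fin N) ℂ))) [IsProbabilityMeasure μ₀],
        ∀ᵐ x ∂(Kernel.trajMeasure (X := fun _ : ℕ => GaugeConfig d L (Matrix.specialUnitaryGroup (Fin N) ℂ)) μ₀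
              (fun n : ℕ => (wilsonJitterHMCL N d L β nstep (uniformJitterLaw τ j)).comap
                (fun h : (i : ↥(Finset.Iic n)) → GaugeConfig d L (Matrix.specialUnitaryGroup (Fin N) ℂ) => h ⟨n, Finset.mem_Iic.2 le_rfl⟩)
                (measurable_pi_apply _))),
          Tendsto (fun n : ℕ => (∑ t ∈ Finset.range n, f (x t) ^ 2) / n - ((∑ t ∈ Finset.range n, f (x t)) / n) ^ 2) atTop
            (𝓝 (∫ z, (f z - ∫ z', f z' ∂(wilsonMeasure (d := d) (L := L) (fundamentalRep (Fin N)) (β / N))) ^ 2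
              ∂(wilsonMeasure (d := d) (L := L) (fundamentalRep (Fin N)) (β / N)))) := by
  obtain ⟨τ₀, hτ₀, h⟩ := wilson_uniformJitterHMC_certificate (N := N) (d := d) (L := L) β
  refine ⟨τ₀, hτ₀, fun nstep τ j hn hτ hj hj1 hshort f hf C hC μ₀ _ => ?_⟩
  obtain ⟨m, ε', hm, hε0, hε1, hmin⟩ := h nstep τ j hn hτ hj hj1 hshort
  exact Scoring.chain_sampleVariance_ae_tendsto_of_nHit
    (wilson_uniformJitterHMC_invariant (N := N) (d := d) (L := L) β nstep τ j) hmin hε0 hf hC μ₀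

/-! ## §2 The jittered `'hmc'` path followed by ANY exact step -/

/-- **(L) FOR THE COMPOSITE `P ∘ K_jit`** — `P` ANY Markov kernel leaving `wilsonMeasure (β/N)` invariant: the time
average of every `π`-integrable `φ` converges to `∫ φ dπ` almost surely, from every start. -/
theorem wilson_uniformJitterHMC_exactStep_timeAverage_ae_tendsto :
    ∃ τ₀ : ℝ, 0 < τ₀ ∧ ∀ (nstep : ℕ) (τ j : ℝ), 1 ≤ nstep → 0 < τ → 0 < j → j ≤ 1 → τ * (1 - j) < τ₀ →
      ∀ (P : Kernel (GaugeConfig d L (Matrix.specialUnitaryGroup (Fin N) ℂ)) (GaugeConfig d L (Matrix.specialUnitaryGroup (Fin N) ℂ)))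
        [IsMarkovKernel P], Invariant P (wilsonMeasure (d := d) (L := L) (fundamentalRep (Fin N)) (β / N)) →
      ∀ (φ : GaugeConfig d L (Matrix.specialUnitaryGroup (Fin N) ℂ) → ℝ), Measurable φ →
          Integrable φ (wilsonMeasure (d := d) (L := L) (fundamentalRep (Fin N)) (β / N)) →
      ∀ (μ₀ : Measure (GaugeConfig d L (Matrix.specialUnitaryGroup (Fin N) ℂ))) [IsProbabilityMeasure μ₀],
        ∀ᵐ x ∂(Kernel.trajMeasure (X := fun _ : ℕ => GaugeConfig d L (Matrix.specialUnitaryGroup (Fin N) ℂ)) μ₀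
              (fun n : ℕ => (P ∘ₖ wilsonJitterHMCL N d L β nstep (uniformJitterLaw τ j)).comap
                (fun h : (i : ↥(Finset.Iic n)) → GaugeConfig d L (Matrix.specialUnitaryGroup (Fin N) ℂ) => h ⟨n, Finset.mem_Iic.2 le_rfl⟩)
                (measurable_pi_apply _))),
          Tendsto (fun n : ℕ => (∑ i ∈ Finset.range n, φ (x i)) / n) atTop
            (𝓝 (∫ a, φ a ∂(wilsonMeasure (d := d) (L := L) (fundamentalRep (Fin N)) (β / N)))) := by
  obtain ⟨τ₀, hτ₀, h⟩ := wilson_uniformJitterHMC_exactStep_certificate (N := N) (d := d) (L := L) β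
  refine ⟨τ₀, hτ₀, fun nstep τ j hn hτ hj hj1 hshort P _ hP φ hφm hφ μ₀ _ => ?_⟩
  obtain ⟨hinv, m, ε', hm, hε0, hε1, hmin⟩ := h nstep τ j hn hτ hj hj1 hshort P hP
  haveI := isMarkovKernel_wilsonJitterHMCL (N := N) (d := d) (L := L) β nstep (uniformJitterLaw τ j)
  exact GeneralNCMC.tendsto_sum_div_anyLaw_of_nHit_minorised hinv hε0.ne' hmin hφm hφ μ₀

end UniformJitter

/-! ## From `EngineExponentialDecorrelation.lean` (GEN-23, atom version) — the uniform-law twin -/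

section UniformJitter

variable {N d L : ℕ} [NeZero N] [NeZero L] (β : ℝ)

/-- **(A) ONE GEOMETRIC RATE FOR THE AUTOCOVARIANCE OF EVERY BOUNDED OBSERVABLE — JITTERED ENGINE HMC.**  There is
`τ₀ > 0` (depending on `N, d, L, β` only) such that whenever `nstep ≥ 1`, `τ > 0`, `0 < j ≤ 1` and
`τ(1 − j) < τ₀`, there are `m > 0` and `0 < ε′ ≤ 1` with `|C_f̄(t)| ≤ 2 (2C)² (1 − ε′)^{⌊t/m⌋}` for
every `|f| ≤ C` measurable and every lag `t`. -/
theorem wilson_uniformJitterHMC_abs_autocov_le :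
    ∃ τ₀ : ℝ, 0 < τ₀ ∧ ∀ (nstep : ℕ) (τ j : ℝ), 1 ≤ nstep → 0 < τ → 0 < j → j ≤ 1 → τ * (1 - j) < τ₀ →
      ∃ m : ℕ, ∃ ε' : ℝ≥0∞, 0 < m ∧ 0 < ε' ∧ ε' ≤ 1 ∧
      ∀ (f : GaugeConfig d L (Matrix.specialUnitaryGroup (Fin N) ℂ) → ℝ), Measurable f → ∀ C : ℝ, (∀ U, |f U| ≤ C) →
        ∀ t : ℕ, |autocov (wilsonJitterHMCL N d L β nstep (uniformJitterLaw τ j)) (wilsonMeasure (d := d) (L := L) (fundamentalRep (Fin N)) (β / N))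
            (fun y => f y - ∫ z, f z ∂(wilsonMeasure (d := d) (L := L) (fundamentalRep (Fin N)) (β / N))) t| ≤ 2 * (2 * C) ^ 2 * (1 - ε'.toReal) ^ (t / m) := by
  obtain ⟨τ₀, hτ₀, h⟩ := wilson_uniformJitterHMC_certificate (N := N) (d := d) (L := L) β
  refine ⟨τ₀, hτ₀, fun nstep τ j hn hτ hj hj1 hshort => ?_⟩
  obtain ⟨m, ε', hm, hε0, hε1, hmin⟩ := h nstep τ j hn hτ hj hj1 hshort
  exact ⟨m, ε', hm, hε0, hε1, fun f hf C hC t => GeneralNCMC.abs_autocov_centred_le_of_nHit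
    (GeneralNCMC.minorised_setwise hmin) hε1 (wilson_uniformJitterHMC_invariant (N := N) (d := d) (L := L) β nstep τ j) hf hC t⟩

/-- **(R) THERMALISATION OF OBSERVABLES FROM ANY START — JITTERED ENGINE HMC**: same `τ₀`, `m`, `ε′`; for every centred
bounded measurable `g` (`∫ g dπ = 0`, `|g| ≤ C_g`), every `t` and EVERY configuration `U`,
`|(K^t g)(U)| ≤ 2 C_g (1 − ε′)^{⌊t/m⌋}`. -/
theorem wilson_uniformJitterHMC_relaxation_le :
    ∃ τ₀ : ℝ, 0 < τ₀ ∧ ∀ (nstep : ℕ) (τ j : ℝ), 1 ≤ nstep → 0 < τ → 0 < j → j ≤ 1 → τ * (1 - j) < τ₀ →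
      ∃ m : ℕ, ∃ ε' : ℝ≥0∞, 0 < m ∧ 0 < ε' ∧ ε' ≤ 1 ∧
        ∀ (g : GaugeConfig d L (Matrix.specialUnitaryGroup (Fin N) ℂ) → ℝ), Measurable g → ∀ Cg : ℝ, (∀ U, |g U| ≤ Cg) →
          ∫ U, g U ∂(wilsonMeasure (d := d) (L := L) (fundamentalRep (Fin N)) (β / N)) = 0 →
          ∀ (t : ℕ) (U : GaugeConfig d L (Matrix.specialUnitaryGroup (Fin N) ℂ)),
            |(kop (wilsonJitterHMCL N d L β nstep (uniformJitterLaw τ j)))^[t] g U|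
              ≤ 2 * Cg * (1 - ε'.toReal) ^ (t / m) := by
  obtain ⟨τ₀, hτ₀, h⟩ := wilson_uniformJitterHMC_certificate (N := N) (d := d) (L := L) β
  refine ⟨τ₀, hτ₀, fun nstep τ j hn hτ hj hj1 hshort => ?_⟩
  obtain ⟨m, ε', hm, hε0, hε1, hmin⟩ := h nstep τ j hn hτ hj hj1 hshort
  exact ⟨m, ε', hm, hε0, hε1, GeneralNCMC.decay_of_nHit (GeneralNCMC.minorised_setwise hmin) hε1
    (wilson_uniformJitterHMC_invariant (N := N) (d := d) (L := L) β nstep τ j)⟩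

/-! ## §2 The jittered `'hmc'` path followed by ANY exact step -/

/-- **(A) FOR THE COMPOSITE `P ∘ K_jit`** — `P` ANY Markov kernel leaving `wilsonMeasure (β/N)` invariant. -/
theorem wilson_uniformJitterHMC_exactStep_abs_autocov_le :
    ∃ τ₀ : ℝ, 0 < τ₀ ∧ ∀ (nstep : ℕ) (τ j : ℝ), 1 ≤ nstep → 0 < τ → 0 < j → j ≤ 1 → τ * (1 - j) < τ₀ →
      ∀ (P : Kernel (GaugeConfig d L (Matrix.specialUnitaryGroup (Fin N) ℂ)) (GaugeConfig d L (Matrix.specialUnitaryGroup (Fin N) ℂ)))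
        [IsMarkovKernel P], Invariant P (wilsonMeasure (d := d) (L := L) (fundamentalRep (Fin N)) (β / N)) →
      ∃ m : ℕ, ∃ ε' : ℝ≥0∞, 0 < m ∧ 0 < ε' ∧ ε' ≤ 1 ∧
      ∀ (f : GaugeConfig d L (Matrix.specialUnitaryGroup (Fin N) ℂ) → ℝ), Measurable f → ∀ C : ℝ, (∀ U, |f U| ≤ C) →
        ∀ t : ℕ, |autocov (P ∘ₖ wilsonJitterHMCL N d L β nstep (uniformJitterLaw τ j)) (wilsonMeasure (d := d) (L := L) (fundamentalRep (Fin N)) (β / N))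
            (fun y => f y - ∫ z, f z ∂(wilsonMeasure (d := d) (L := L) (fundamentalRep (Fin N)) (β / N))) t| ≤ 2 * (2 * C) ^ 2 * (1 - ε'.toReal) ^ (t / m) := by
  obtain ⟨τ₀, hτ₀, h⟩ := wilson_uniformJitterHMC_exactStep_certificate (N := N) (d := d) (L := L) β
  refine ⟨τ₀, hτ₀, fun nstep τ j hn hτ hj hj1 hshort P _ hP => ?_⟩
  obtain ⟨hinv, m, ε', hm, hε0, hε1, hmin⟩ := h nstep τ j hn hτ hj hj1 hshort P hP
  haveI := isMarkovKernel_wilsonJitterHMCL (N := N) (d := d) (L := L) β nstep (uniformJitterLaw τ j)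
  exact ⟨m, ε', hm, hε0, hε1, fun f hf C hC t =>
    GeneralNCMC.abs_autocov_centred_le_of_nHit (GeneralNCMC.minorised_setwise hmin) hε1 hinv hf hC t⟩

/-- **(R) FOR THE COMPOSITE `P ∘ K_jit`**: thermalisation of every centred bounded observable from any start. -/
theorem wilson_uniformJitterHMC_exactStep_relaxation_le :
    ∃ τ₀ : ℝ, 0 < τ₀ ∧ ∀ (nstep : ℕ) (τ j : ℝ), 1 ≤ nstep → 0 < τ → 0 < j → j ≤ 1 → τ * (1 - j) < τ₀ →
      ∀ (P : Kernel (GaugeConfig d L (Matrix.specialUnitaryGroup (Fin N) ℂ)) (GaugeConfig d L (Matrix.specialUnitaryGroup (Fin N) ℂ)))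
        [IsMarkovKernel P], Invariant P (wilsonMeasure (d := d) (L := L) (fundamentalRep (Fin N)) (β / N)) →
      ∃ m : ℕ, ∃ ε' : ℝ≥0∞, 0 < m ∧ 0 < ε' ∧ ε' ≤ 1 ∧
        ∀ (g : GaugeConfig d L (Matrix.specialUnitaryGroup (Fin N) ℂ) → ℝ), Measurable g → ∀ Cg : ℝ, (∀ U, |g U| ≤ Cg) →
          ∫ U, g U ∂(wilsonMeasure (d := d) (L := L) (fundamentalRep (Fin N)) (β / N)) = 0 →
          ∀ (t : ℕ) (U : GaugeConfig d L (Matrix.specialUnitaryGroup (Fin N) ℂ)),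
            |(kop (P ∘ₖ wilsonJitterHMCL N d L β nstep (uniformJitterLaw τ j)))^[t] g U|
              ≤ 2 * Cg * (1 - ε'.toReal) ^ (t / m) := by
  obtain ⟨τ₀, hτ₀, h⟩ := wilson_uniformJitterHMC_exactStep_certificate (N := N) (d := d) (L := L) β
  refine ⟨τ₀, hτ₀, fun nstep τ j hn hτ hj hj1 hshort P _ hP => ?_⟩
  obtain ⟨hinv, m, ε', hm, hε0, hε1, hmin⟩ := h nstep τ j hn hτ hj hj1 hshort P hP
  haveI := isMarkovKernel_wilsonJitterHMCL (N := N) (d := d) (L := L) β nstep (uniformJitterLaw τ j)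
  exact ⟨m, ε', hm, hε0, hε1, GeneralNCMC.decay_of_nHit (GeneralNCMC.minorised_setwise hmin) hε1 hinv⟩

end UniformJitter

end Summit.Ventures.LatticeQCDFlow.Exactness
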